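import Mathlib
import Summits.KontsevichZagierPeriods.Zeta5Search.TSOriginDataO62B1
import Summits.KontsevichZagierPeriods.Zeta5Search.TSOriginDataO62B2
import Summits.KontsevichZagierPeriods.Zeta5Search.TSOriginDataO62B3
import Summits.KontsevichZagierPeriods.Zeta5Search.TSOriginDataO62B4
import Summits.KontsevichZagierPeriods.Zeta5Search.TSOriginDataO62B5
import Summits.KontsevichZagierPeriods.Zeta5Search.TSOriginDataO62B6
import Summits.KontsevichZagierPeriods.Zeta5Search.TSOriginDataO62B7
import HarnessLib

/-!
# ζ(5) search — data of gen-2 g13's ORIGIN type-space window `M = 62` (`14 * n < 17 * p`,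
    `6 * p ≤ 5 * n`) (part 9/9) (HONEST FRAMING: systematic search; no irrationality claim unless certified)

Cell `pub-zeta5`, prover seat p3 generation 3 (generated by `code/gen/tsdata.py`).  Inventory of the window (all odd `p`, `n ≤ 150`,
    `code/gen/tswin.py`):
deep types `D62` (3), centre-free sub-deep types `S62` (6), odd-centre types `P62` (0); ALL type-level doubled orbit points lie on ONE line:
primitive direction `u62 = (39549306551943765531317081836159930667824438816181760000, -60005993380462402421439513912491821413290079887218406539)`,
    `Φ_u = u₁V − u₂W = c62 = -588720717425722350870523333045959528181351991373259552158245384644339/125677405417868831586847005690612940800000000`; every deep orbit vector is `∥ u62`.  Each identity is PROVED by the computable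
mirror `TypeEval.typeRho_eq_typeRhoC` + `decide +kernel`; `lineData62 : LineData u62 c62 D62 S62 P62` feeds `OriginWindows.deep_dir/lineVal_live`
in the machine file `TSWindowO62.lean` (`ResidueLaw.RecTSClassesO62`, `RecWindowTSM62`).  Rational bookkeeping; nothing here bears on irrationality.
-/

noncomputable section

open Finset

namespace Summit.KontsevichZagierPeriods.Zeta5Search.OriginWindows

open Summit.KontsevichZagierPeriods.Zeta5Search.SecondOrder
open Summit.KontsevichZagierPeriods.Zeta5Search.LevelClass (typeW typeV)
open Summit.KontsevichZagierPeriods.Zeta5Search.ZeroWindows (deepPoint pairPoint)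
open Summit.KontsevichZagierPeriods.Zeta5Search.TypeEval (typeRho_eq_typeRhoC)

variable {p : ℕ} [hp : Fact p.Prime]

/-- The `LineData` part of the line data of the `M = 62` window. -/
theorem lineData62' : LineData u62 c62 D62 S62 P62 := by
  refine ⟨?_, ?_, ?_⟩
  · intro T hT
    simp only [D62, List.mem_cons, List.not_mem_nil, or_false] at hT
    rcases hT with rfl | rfl | rfl
    · exact ⟨d62_dir_1, d62_pt_1⟩
    · exact ⟨d62_dir_2, d62_pt_2⟩
    · exact ⟨d62_dir_3, d62_pt_3⟩
  · intro s hs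
    simp only [S62, List.mem_cons, List.not_mem_nil, or_false] at hs
    rcases hs with rfl | rfl | rfl | rfl | rfl | rfl
    · exact s62_pt_1
    · exact s62_pt_2
    · exact s62_pt_3
    · exact s62_pt_4
    · exact s62_pt_5
    · exact s62_pt_6
  · intro T hT
    simp [P62] at hT

/-- **The extended line data of the `M = 62` window HOLD.** -/
theorem lineData62 : LineDataC u62 c62 D62 S62 P62 C62 := by
  refine ⟨lineData62', fun T hT => ?_⟩
  simp only [C62, List.mem_cons, List.not_mem_nil, or_false] at hT
  rcases hT with rfl
  exact e62_pt_1

omit hp in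
/-- `u62` is primitive, so never `≡ 0 (mod p)`. -/
theorem u62_ne (hq : p.Prime) : ¬ ((p : ℤ) ∣ u62.1 ∧ (p : ℤ) ∣ u62.2) := by
  rintro ⟨h1, h2⟩
  have h := Int.dvd_gcd h1 h2
  rw [show Int.gcd u62.1 u62.2 = 1 by decide +kernel] at h
  exact hq.one_lt.ne' (Nat.dvd_one.1 h)

end Summit.KontsevichZagierPeriods.Zeta5Search.OriginWindows

end
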